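/-
Copyright (c) 2026 the pub-hodgecm-mathlib formalisation cell (harness21).  Prover seat hodgecm-mathlib-LH4-p05 (g0): Track A «(D-RAM) FOUR-FRAME» squad of crux H413
(dealer LH4-plan (g10) WORD #29 ∕ heir LEAD F0P3a-plan (g19) T18-07 (3): «(f) `stub_U2H_leviRow_wild` → p05», HOME census v2 §E, brick L1), 2026-09-03.
-/
import Literature.NumberTheory.Automorphic.QuadraticPlaceDescentPins          -- ★ `galAdicCompletionMap_eq_self_iff_mem_range` (Galois descent at a non-split completion), `toPlace_eq_algebraMap_adicCompletion`
import Literature.NumberTheory.Automorphic.RamifiedPlaceAntiFixedUniformizer     -- ★ the TAME rows (`|2|_w = 1`) this file frees from `|2|_w = 1`; brings ★ `valued_toPlace`, ★ `ramificationIdx'_eq_two_of_ne_one`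
import HarnessLib

/-!
# Valuation parity at ANY ramified non-split place of a quadratic extension: fixed elements have even order; with an anti-fixed uniformiser,
# anti-fixed elements have odd order and the integral skew line lies in `𝔪_w` — WITHOUT `|2|_w = 1`

Topic `NumberTheory/LocalFields`; namespace `Literature.NumberTheory.LocalFields.RamifiedPlaceFixedValuationParity`.  THEOREMS ONLY (no definition, no instance, no
notation, no named fact, no `sorry`).  Cell `pub/hodgecm-mathlib`, crux H413 = `stmt-HodgeConjecture-24833` (lane `--supports`, count-neutral), Track A «(D-RAM) FOUR-FRAME»,
unit U2H child (f) `stub_U2H_leviRow_wild` (LH4-p05 (g0) census v2 8155187a2585211d §B∕§E): the WILD port of the tame Levi∕line-strata ★ stock hinges on ONE root fact,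
★ `LineStrataMeasureRamified.valued_skew_apply_lt_one_of_ramified` «an integral skew element lies in `𝔪_w`», proved there from `σ_w ≡ id (mod 𝔪_w)` AND `|2|_w = 1`.
This file proves the same conclusion at EVERY ramified non-split place that carries an ANTI-FIXED UNIFORMISER (`σ_w θ = −θ`, `v_w(θ) = exp(−1)`: all tamely ramified
places, ★ `exists_uniformizer_galAdicCompletionMap_eq_neg_of_ramified`, and the wild places of «uniformiser type» `E_w = F_v(√(u·π))`), with no hypothesis on `|2|_w`;
at the other wild type (`E_w = F_v(√u)`, an anti-fixed UNIT exists) the conclusion is false, so the hypothesis is sharp.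

THE MATHEMATICS ([SerreLocalFields1979] Ch. II §3, Ch. III §6, Ch. IV §2; [CasselsFrohlichANT1967] Ch. VII §1.1).  `E∕F` a quadratic extension of number fields with
non-trivial automorphism `c`, `w ∣ v` a finite place of `E` fixed by `c` (non-split) and RAMIFIED (`e(w|v) ≠ 1`, hence `= 2`, ★ `ramificationIdx'_eq_two_of_ne_one`),
`σ_w` the induced automorphism of `E_w` (★ `galAdicCompletionMap`).
* §1 `even_log_valued_of_galAdicCompletionMap_eq_self`: a `σ_w`-FIXED `x ≠ 0` has EVEN order — Galois descent `σ_w x = x ↔ x ∈ ι_w(F_v)` (★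
  `galAdicCompletionMap_eq_self_iff_mem_range`, place-generic) and `v_w(ι_w a) = v_v(a)^{e(w|v)} = v_v(a)²` (★ `valued_toPlace`).  No `|2|_w = 1` (contrast ★
  `even_log_valued_of_galAdicCompletionMap_eq_of_ramified`, which goes through an anti-fixed uniformiser and `|2|_w = 1`).
* §2 with an anti-fixed uniformiser `θ`: `odd_log_valued_of_galAdicCompletionMap_eq_neg_of_uniformizer` (anti-fixed `y ≠ 0` ⇒ `yθ` fixed ⇒ `y` has ODD order),
  `valued_ne_one_of_galAdicCompletionMap_eq_neg_of_uniformizer` (no anti-fixed unit), `valued_lt_one_of_galAdicCompletionMap_eq_neg_of_uniformizer`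
  (`|y|_w ≤ 1 ⇒ |y|_w < 1`: the integral skew line lies in `𝔪_w`) — the `|2|`-free twins of ★ `odd_log_valued_of_galAdicCompletionMap_eq_neg` ∕ ★
  `valued_lt_one_of_galAdicCompletionMap_eq_neg`.
* §3 the CM rows (`F = L⁺`, `c` = complex conjugation), the currency of ★ `LineStrataMeasureRamified` and of the U2H Levi∕type-(2) ports.

HONEST LABEL: HC_CM is proved only modulo the 7 printed citations (2 remaining named inputs: hLiu418 = `stmt-HodgeConjecture-24832`, h413 = `stmt-HodgeConjecture-24833`) until
rung 0 closes; this file is unconditional local algebra, asserts nothing printed and freezes no stub text.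

## References
* [SerreLocalFields1979] J.-P. Serre, *Local Fields*, GTM 67 (1979): Ch. II §3 (closed subfields of complete fields), Ch. III §6 (ramification in quadratic extensions),
  Ch. IV §2 Prop. 5.
* [CasselsFrohlichANT1967] J. W. S. Cassels, A. Fröhlich (eds.), *Algebraic Number Theory* (1967), Ch. VII §1.1 (the decomposition group acts on `E_w`; fixed field `F_v`).
* [Jacobowitz1962] R. Jacobowitz, *Hermitian forms over local fields*, Amer. J. Math. 84 (1962), §5 (ramified dyadic and non-dyadic quadratic extensions: the two types).
-/

set_option autoImplicit false

noncomputable section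

open NumberField IsDedekindDomain
open Literature.NumberTheory.Automorphic Literature.NumberTheory.Automorphic.UnitaryGroup
open Literature.NumberTheory.Automorphic.Liu2021.LemD1IndexedNonVacuityRamifiedPlace (ramificationIdx'_eq_two_of_ne_one)

namespace Literature.NumberTheory.LocalFields.RamifiedPlaceFixedValuationParity

variable {F : Type} (E : Type) [Field F] [NumberField F] [Field E] [NumberField E] [Algebra F E]
  [Algebra.IsQuadraticExtension F E] (c : E ≃ₐ[F] E) {v : HeightOneSpectrum (𝓞 F)}

/-! ## §1 Fixed elements have even order at ANY ramified non-split place -/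

/-- **A `σ_w`-FIXED NON-ZERO ELEMENT HAS EVEN ORDER at a ramified non-split place** — no `|2|_w = 1`: `σ_w x = x` puts `x` in `ι_w(F_v)` (Galois descent at the
completion, ★ `galAdicCompletionMap_eq_self_iff_mem_range`), and `v_w(ι_w a) = v_v(a)²` since `e(w|v) = 2`. [cite: CasselsFrohlichANT1967, Ch. VII §1.1]
[cite: SerreLocalFields1979, Ch. III §6] -/
theorem even_log_valued_of_galAdicCompletionMap_eq_self (hc : c ≠ 1) (w : PlacesOver E v) (hw : c • w.1 = w.1)
    (he : v.asIdeal.ramificationIdx' w.1.asIdeal ≠ 1) {x : w.1.adicCompletion E} (hx0 : x ≠ 0)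
    (hσx : galAdicCompletionMap (L := E) c hw x = x) : Even (WithZero.log (Valued.v x)) := by
  obtain ⟨a, ha⟩ := (galAdicCompletionMap_eq_self_iff_mem_range c hc v w hw x).1 hσx
  have hxa : Valued.v x = Valued.v a ^ 2 := by
    rw [← ha, ← toPlace_eq_algebraMap_adicCompletion, valued_toPlace, ramificationIdx'_eq_two_of_ne_one E v c hc w hw he]
  have ha0 : Valued.v a ≠ 0 := by
    intro h
    apply hx0
    rw [← (Valuation.zero_iff _ : Valued.v x = 0 ↔ x = 0), hxa, h, zero_pow two_ne_zero]
  refine ⟨WithZero.log (Valued.v a), ?_⟩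
  rw [hxa, WithZero.log_pow, two_nsmul]

/-- The same in power currency: a fixed `x ≠ 0` has `v_w(x) = exp(2k)` for some `k ∈ ℤ`. [cite: SerreLocalFields1979, Ch. III §6] -/
theorem exists_valued_eq_exp_two_mul_of_galAdicCompletionMap_eq_self (hc : c ≠ 1) (w : PlacesOver E v) (hw : c • w.1 = w.1)
    (he : v.asIdeal.ramificationIdx' w.1.asIdeal ≠ 1) {x : w.1.adicCompletion E} (hx0 : x ≠ 0)
    (hσx : galAdicCompletionMap (L := E) c hw x = x) : ∃ k : ℤ, Valued.v x = WithZero.exp (2 * k) := by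
  obtain ⟨k, hk⟩ := even_log_valued_of_galAdicCompletionMap_eq_self E c hc w hw he hx0 hσx
  refine ⟨k, ?_⟩
  have h := WithZero.exp_log (x := Valued.v x) ((Valuation.ne_zero_iff _).2 hx0)
  rw [← h, hk, two_mul]

/-! ## §2 With an anti-fixed uniformiser: anti-fixed elements have odd order; no anti-fixed unit; the integral skew line lies in `𝔪_w` -/

/-- **ANTI-FIXED NON-ZERO ELEMENTS HAVE ODD ORDER** at a ramified non-split place carrying an anti-fixed uniformiser `θ` (`σ_w θ = −θ`, `v_w θ = exp(−1)`):
`σ_w y = −y`, `y ≠ 0` ⇒ `yθ` is fixed, of even order (§1), so `log v_w y = 2k + 1`.  The `|2|`-free twin of ★ `odd_log_valued_of_galAdicCompletionMap_eq_neg`.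
[cite: SerreLocalFields1979, Ch. IV §2 Prop. 5; Ch. III §6] [cite: Jacobowitz1962, §5] -/
theorem odd_log_valued_of_galAdicCompletionMap_eq_neg_of_uniformizer (hc : c ≠ 1) (w : PlacesOver E v) (hw : c • w.1 = w.1)
    (he : v.asIdeal.ramificationIdx' w.1.asIdeal ≠ 1) {θ : w.1.adicCompletion E} (hθ : Valued.v θ = WithZero.exp (-1 : ℤ))
    (hσθ : galAdicCompletionMap (L := E) c hw θ = -θ) {y : w.1.adicCompletion E} (hy0 : y ≠ 0)
    (hσy : galAdicCompletionMap (L := E) c hw y = -y) : Odd (WithZero.log (Valued.v y)) := by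
  have hθ0 : θ ≠ 0 := fun h => by rw [h, map_zero] at hθ; exact WithZero.zero_ne_coe hθ
  have hfix : galAdicCompletionMap (L := E) c hw (y * θ) = y * θ := by rw [map_mul, hσy, hσθ, neg_mul_neg]
  obtain ⟨k, hk⟩ := even_log_valued_of_galAdicCompletionMap_eq_self E c hc w hw he (mul_ne_zero hy0 hθ0) hfix
  rw [map_mul, WithZero.log_mul ((Valuation.ne_zero_iff _).2 hy0) ((Valuation.ne_zero_iff _).2 hθ0), hθ, WithZero.log_exp] at hk
  exact ⟨k, by omega⟩

/-- **NO ANTI-FIXED UNIT** at such a place: `σ_w y = −y` ⇒ `v_w(y) ≠ 1` (odd order, or `y = 0`). [cite: SerreLocalFields1979, Ch. IV §2 Prop. 5] [cite: Jacobowitz1962, §5] -/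
theorem valued_ne_one_of_galAdicCompletionMap_eq_neg_of_uniformizer (hc : c ≠ 1) (w : PlacesOver E v) (hw : c • w.1 = w.1)
    (he : v.asIdeal.ramificationIdx' w.1.asIdeal ≠ 1) {θ : w.1.adicCompletion E} (hθ : Valued.v θ = WithZero.exp (-1 : ℤ))
    (hσθ : galAdicCompletionMap (L := E) c hw θ = -θ) {y : w.1.adicCompletion E}
    (hσy : galAdicCompletionMap (L := E) c hw y = -y) : Valued.v y ≠ 1 := by
  intro h1
  by_cases hy0 : y = 0
  · rw [hy0, map_zero] at h1; exact zero_ne_one h1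
  · obtain ⟨k, hk⟩ := odd_log_valued_of_galAdicCompletionMap_eq_neg_of_uniformizer E c hc w hw he hθ hσθ hy0 hσy
    rw [h1, WithZero.log_one] at hk
    omega

/-- **THE INTEGRAL SKEW LINE LIES IN `𝔪_w`** at such a place: `σ_w y = −y`, `v_w(y) ≤ 1` ⇒ `v_w(y) < 1` — the `|2|`-free twin of ★ `valued_lt_one_of_galAdicCompletionMap_eq_neg`
and of the root ★ `LineStrataMeasureRamified.valued_skew_apply_lt_one_of_ramified`. [cite: SerreLocalFields1979, Ch. IV §2 Prop. 5] [cite: Jacobowitz1962, §5] -/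
theorem valued_lt_one_of_galAdicCompletionMap_eq_neg_of_uniformizer (hc : c ≠ 1) (w : PlacesOver E v) (hw : c • w.1 = w.1)
    (he : v.asIdeal.ramificationIdx' w.1.asIdeal ≠ 1) {θ : w.1.adicCompletion E} (hθ : Valued.v θ = WithZero.exp (-1 : ℤ))
    (hσθ : galAdicCompletionMap (L := E) c hw θ = -θ) {y : w.1.adicCompletion E} (hy : Valued.v y ≤ 1)
    (hσy : galAdicCompletionMap (L := E) c hw y = -y) : Valued.v y < 1 :=
  lt_of_le_of_ne hy (valued_ne_one_of_galAdicCompletionMap_eq_neg_of_uniformizer E c hc w hw he hθ hσθ hσy)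

/-- **CONVERSELY, an anti-fixed UNIT excludes anti-fixed uniformisers** (the other wild type `E_w = F_v(√u)`): if `σ_w α = −α`, `v_w α = 1`, then no `θ` with `σ_w θ = −θ`,
`v_w θ = exp(−1)` exists — the hypothesis of §2 is sharp. [cite: Jacobowitz1962, §5] [cite: SerreLocalFields1979, Ch. IV §2] -/
theorem not_exists_uniformizer_galAdicCompletionMap_eq_neg_of_unit (hc : c ≠ 1) (w : PlacesOver E v) (hw : c • w.1 = w.1)
    (he : v.asIdeal.ramificationIdx' w.1.asIdeal ≠ 1) {α : w.1.adicCompletion E} (hα : Valued.v α = 1)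
    (hσα : galAdicCompletionMap (L := E) c hw α = -α) :
    ¬ ∃ θ : w.1.adicCompletion E, Valued.v θ = WithZero.exp (-1 : ℤ) ∧ galAdicCompletionMap (L := E) c hw θ = -θ := by
  rintro ⟨θ, hθ, hσθ⟩
  exact valued_ne_one_of_galAdicCompletionMap_eq_neg_of_uniformizer E c hc w hw he hθ hσθ hσα hα

/-! ## §3 The CM rows -/

/-- **CM ROW (fixed ⇒ even order)**: `L` CM, `w ∣ v` a place of `L` fixed by complex conjugation and ramified over `L⁺`; a `c_w`-fixed `x ≠ 0` of `L_w` has even order —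
ANY such place, wild included. [cite: SerreLocalFields1979, Ch. III §6] [cite: CasselsFrohlichANT1967, Ch. VII §1.1] -/
theorem even_log_valued_of_complexConj_eq_self (L : Type) [Field L] [NumberField L] [IsCMField L]
    {v : HeightOneSpectrum (𝓞 ↥(maximalRealSubfield L))} (w : PlacesOver L v) (hw : IsCMField.complexConj L • w.1 = w.1)
    (he : v.asIdeal.ramificationIdx' w.1.asIdeal ≠ 1) {x : w.1.adicCompletion L} (hx0 : x ≠ 0)
    (hσx : galAdicCompletionMap (L := L) (IsCMField.complexConj L) hw x = x) : Even (WithZero.log (Valued.v x)) :=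
  haveI : Algebra.IsQuadraticExtension ↥(maximalRealSubfield L) L := IsCMField.isQuadraticExtension L
  even_log_valued_of_galAdicCompletionMap_eq_self L (IsCMField.complexConj L) (IsCMField.complexConj_ne_one L) w hw he hx0 hσx

/-- **CM ROW (integral skew line in `𝔪_w`, `|2|`-free)**: at a ramified non-split CM place with an anti-fixed uniformiser `θ`, every `c_w`-anti-fixed `y` with `v_w(y) ≤ 1` has
`v_w(y) < 1`. [cite: SerreLocalFields1979, Ch. IV §2 Prop. 5] [cite: Jacobowitz1962, §5] -/
theorem valued_lt_one_of_complexConj_eq_neg_of_uniformizer (L : Type) [Field L] [NumberField L] [IsCMField L]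
    {v : HeightOneSpectrum (𝓞 ↥(maximalRealSubfield L))} (w : PlacesOver L v) (hw : IsCMField.complexConj L • w.1 = w.1)
    (he : v.asIdeal.ramificationIdx' w.1.asIdeal ≠ 1) {θ : w.1.adicCompletion L} (hθ : Valued.v θ = WithZero.exp (-1 : ℤ))
    (hσθ : galAdicCompletionMap (L := L) (IsCMField.complexConj L) hw θ = -θ) {y : w.1.adicCompletion L} (hy : Valued.v y ≤ 1)
    (hσy : galAdicCompletionMap (L := L) (IsCMField.complexConj L) hw y = -y) : Valued.v y < 1 :=
  haveI : Algebra.IsQuadraticExtension ↥(maximalRealSubfield L) L := IsCMField.isQuadraticExtension L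
  valued_lt_one_of_galAdicCompletionMap_eq_neg_of_uniformizer L (IsCMField.complexConj L) (IsCMField.complexConj_ne_one L) w hw he hθ hσθ hy hσy

/-- **CM ROW (odd order)**: at such a place every `c_w`-anti-fixed `y ≠ 0` has odd order. [cite: SerreLocalFields1979, Ch. IV §2 Prop. 5] [cite: Jacobowitz1962, §5] -/
theorem odd_log_valued_of_complexConj_eq_neg_of_uniformizer (L : Type) [Field L] [NumberField L] [IsCMField L]
    {v : HeightOneSpectrum (𝓞 ↥(maximalRealSubfield L))} (w : PlacesOver L v) (hw : IsCMField.complexConj L • w.1 = w.1)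
    (he : v.asIdeal.ramificationIdx' w.1.asIdeal ≠ 1) {θ : w.1.adicCompletion L} (hθ : Valued.v θ = WithZero.exp (-1 : ℤ))
    (hσθ : galAdicCompletionMap (L := L) (IsCMField.complexConj L) hw θ = -θ) {y : w.1.adicCompletion L} (hy0 : y ≠ 0)
    (hσy : galAdicCompletionMap (L := L) (IsCMField.complexConj L) hw y = -y) : Odd (WithZero.log (Valued.v y)) :=
  haveI : Algebra.IsQuadraticExtension ↥(maximalRealSubfield L) L := IsCMField.isQuadraticExtension L
  odd_log_valued_of_galAdicCompletionMap_eq_neg_of_uniformizer L (IsCMField.complexConj L) (IsCMField.complexConj_ne_one L) w hw he hθ hσθ hy0 hσy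

end Literature.NumberTheory.LocalFields.RamifiedPlaceFixedValuationParity

end
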